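import Mathlib
import HarnessLib
import HarnessLib.Audit
import Summits.ResolutionOfSingularities.Statement
import Literature.AlgebraicGeometry.Motives.VarietiesProjectiveSpaceProofs
import Literature.AlgebraicGeometry.Resolution.QuasiExcellentSchemes
import Literature.AlgebraicGeometry.Resolution.Principalization
import Literature.AlgebraicGeometry.Resolution.Temkin2008Localization
import Literature.AlgebraicGeometry.Resolution.LogRegularSchemeEtale
import HarnessLib.Audit.Status.Attr

/-!
Route: CleanCovers

DORMANT since 2026-08-29T19:42:32Z (census g0: costume|duplicate of —; reader census-reader-61-g0) — unstaffed, not closed; items shared with open routes are served there. `ledger route dormant <id> --off` reactivates.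

# Route CleanCovers — Kedlaya covers of P^n; clean the wild ramification on the base, then
log-regularity

It suffices to show, for every prime p, X = CoverResolution_p ∧ KedlayaReduction_p, plus the shared
descent
DescentPerfectToAll (route Descent, stmt-0549). CoverResolution_p (crux, rank 2): every INTEGRAL
scheme X with a FINITE
SURJECTIVE morphism f : X → P^n_k (k perfect of characteristic p, any n) that is ETALE over the
standard chart D_+(x_n) ≅ A^n
has a resolution. KedlayaReduction_p (crux, rank 3): CoverResolution_p ⇒ every reduced separated
k-scheme of finite type (k perfect,
char p) has a resolution — the in-tree projective reduction (irreducible components, Chow,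
projective closure: it suffices to
resolve integral closed subschemes of P^n_k), then Kedlaya's normal form (Kedlaya2004 Thm 1: every
geometrically reduced
projective X of pure dimension n admits a finite f : X → P^n etale away from ONE hyperplane H with
Sing X ↦ H) plus
normalisation. So ALL
singularities of characteristic p are normalisations of P^n in finite etale covers of A^n: the
discriminant is a smooth
hyperplane, the residue is pure wild ramification along it. Cards realised: kedlaya-normal-form
(spine: the reformulation),
wild-jung-ramification-hahn (the engine: clean the ramification, then toric). The engine (filed as
informal layer-2 items at
open, see Two-layer plan) attacks CoverResolution_p by BASE-ONLY blow-ups read off ramification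
data: Abbes–Saito's (NpS)
(inertia with normal p-Sylow after admissible blow-up + normalisation, AbbesSaito2011 §2 Prop. 15)
and Kato/Abbes–Saito
CLEANLINESS of the Galois closure along the snc boundary (AbbesSaito2011 §1.13, Yatagawa2022 p. 2:
expected in all
dimensions, Kato1994Ramification Thm 4.1 in dimension 2), then 'clean + p-by-tame inertia ⇒
log-regular' (tame part:
Abhyankar's lemma, GrothendieckMurre1971 2.3.2; wild part: elementary-abelian Artin–Schreier layers,
fierce layer = support
FierceCleanRegular, mixed layer = toric x^R = π^p), then Kato1994 (10.4)/Niziol2006 5.8 (log-regular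
⇒ resolved).
Lean: `CoverResolution ∧ KedlayaReduction ∧ DescentPerfectToAll`

## Assembly
Pure logic (rev 1, cone repair): fix p; CoverResolution_p feeds KedlayaReduction_p, whose conclusion
— resolution of every
reduced separated finite-type X over every perfect k of characteristic p — is verbatim the
hypothesis of DescentPerfectToAll,
which returns ResolutionInChar p. Deciding theorem `closes (hC : CoverResolution) (hK :
KedlayaReduction)
(hD : DescentPerfectToAll) : _root_.ResolutionOfSingularities := fun p hp => hD p hp (hK p hp (hC p
hp))` elaborates
sorry-free (Sketch.lean / glue.lean, axioms propext · Classical.choice · Quot.sound). The PROVED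
tree reduction
`Theorems.WeightedThesis.ProjectiveIntegralSuffices.stub_projectiveIntegralSuffices` (used by rev
0's glue) is now an
ingredient of the proof of KedlayaReduction, not of the glue, so the route file imports no
`Literature.AlgebraicGeometry.Resolution.*` module beyond the one the Statement itself imports.

Rationale: WHY THIS LINE. Jung's method (project, resolve the discriminant, read the cover off the
normal-crossings branch locus) is the oldest
induction on dimension and dies in characteristic p at two places (Abhyankar1955; Piltant2003 p.
1238): the discriminant must
be embedded-resolved one dimension down, and above a normal-crossings branch locus the cover is wild
(no Abhyankar–Jung, local
Galois groups not solvable). Kedlaya2004 Thm 1 removes the first for free — in characteristic p the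
branch divisor can be taken
to be ONE SMOOTH HYPERPLANE (π_1(A^n) is huge: obstruction as resource) — and AbbesSaito2011 Prop.
15 removes non-solvability
(after a U-admissible blow-up of the base and normalisation every inertia group is p-group ⋊
prime-to-p), leaving exactly the
object that l-adic ramification theory with imperfect residue fields was built for (Kato1989,
Kato1994Ramification, AbbesSaito2011,
Yatagawa2022): a finite etale cover of A^n ⊂ P^n, to be made CLEAN along the boundary by blow-ups of
the base, after which (the
bet) its normalisation is log-regular and Kato1994 (10.4) resolves it combinatorially. Imported:
arithmetic geometry of etale
covers of affine spaces (Abhyankar/Kedlaya), ramification theory of local fields with imperfect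
residue field (Kato, Abbes–Saito,
Saito, Yatagawa), logarithmic geometry (Kato1994, Niziol2006). It answers in the large Piltant2003's
'Jung problem' (dim 2,
valuative, toric tops after base blow-ups: Thms 5.3/6.5/7.1, general defect case open) and
MourtadaSchober2025's printed call for
'an analogue in characteristic p of Jung's approach'. No open route touches covers of P^n,
conductors, or log-regularity:
Valuative/CyclicCovers uniformize along valuations and patch; pAlteration isolates the INSEPARABLE
residue t^p = f, this line
the SEPARABLE-WILD residue (Kedlaya: no radicial cover is ever needed); WeightedInvariant runs an
invariant; Descent /
UniformComplexity move the ground field.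

RANKED CRUXES. #2 CoverResolution (crux) — for every prime p, every perfect field k of
characteristic p, every n, every integral scheme X and every finite surjective f : X → P^n_k which
is etale over the chart D_+(x_n) ≅ A^n_k, X has a resolution (proper birational X' → X with X'
regular). The Kedlaya normal form of the summit over perfect fields (card kedlaya-normal-form,
K0/CoverRes_n); attacked by the cleaning engine (Two-layer plan). [difficulty: open-problem] (why it
might fail: equivalent to the summit over perfect fields (Kedlaya), open in dim ≥ 4; the engine's
clean models may need blow-ups of the COVER (non-abelian p-inertia; embedded resolution of the
non-clean locus inside H, dim n-1) — then base-only cleaning stalls.) [Kedlaya2004, AbbesSaito2011,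
Piltant2003, Kato1994Ramification, Yatagawa2022, arXiv:math/0303382]
#3 KedlayaReduction (crux) — for every prime p: CoverResolution at p ⇒ every reduced separated
k-scheme of finite type over a perfect field k of characteristic p has a resolution (restated at rev
1, cone repair: the conclusion is now verbatim the hypothesis of DescentPerfectToAll; rev 0
concluded only for integral closed subschemes X ⊆ P^n_k and left the projective reduction to the
glue). Proof on paper: the PROVED tree reduction
`Theorems.WeightedThesis.ProjectiveIntegralSuffices.stub_projectiveIntegralSuffices` =
`ResolutionOverUpToDim.of_projective` (irreducible components with reduced structure, Chow,
projective closure; CossartPiltant2019 Prop. 4.6 Steps 1–3) reduces to integral closed subschemes X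
⊆ P^n_k; normalise X (tree: Scheme.HasResolution.of_normalization), Kedlaya2004 Thm 1 with L = O(1),
D = the non-smooth locus (dim < dim X since k perfect), S = ∅ gives a finite f : X^ν → P^d etale
away from a hyperplane, which a linear change of coordinates makes V_+(x_d); f is surjective since
dim X^ν = d; CoverResolution resolves X^ν, hence X. [difficulty: L] (why it might fail: only if
mis-typed: Kedlaya's 'etale away from H' must match `Etale (f ∣_ D_+(x_n))` after a projective
linear coordinate change on Mathlib's Proj, and the normalisation must be projective (finite over
projective) to carry the ample L.) [Kedlaya2004, arXiv:math/0303382, arXiv:math/0207150,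
CossartPiltant2019]
#4 DescentPerfectToAll (crux) — for every prime p, resolution of all reduced separated finite-type
schemes over all PERFECT fields of characteristic p implies ResolutionInChar p (shared verbatim with
routes Descent and WeightedInvariant, stmt-0549; Kedlaya needs geometrically reduced X, i.e. perfect
k, cf. Literature.Barriers.ResolutionOfSingularities.InseparableBaseChange). [difficulty:
open-problem] (why it might fail: regular is not geometrically regular under inseparable
ground-field extension (EGA IV 6.7.4,
Literature.Barriers.ResolutionOfSingularities.RegularNotGeometricallyRegular); spreading out needs
k/K0 separable beyond the p-rank of k (Temkin2008 Q 3.3.3 open).) [Temkin2008, CossartPiltant2009,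
Liu2002]
#9 FierceCleanRegular (support) — the fierce-clean Artin–Schreier layer is regular (first lemma of
'clean ⇒ log-regular'): A a regular local ring of characteristic p, x ∈ m, e ≥ 1, u, a ∈ A with u −
a^p ∈ m and u − a^p + x^{e(p−1)}·a ∉ m² (this is implied by Kato log-cleanliness of the class
u/x^{pe} at the closed point); then every localisation of A[w]/(w^p − x^{e(p−1)} w − u) at a prime
over m is a regular local ring (the unique such prime is (m, w − a); the hypersurface equation is ≡
−(u − a^p + x^{e(p−1)}a) mod (m, w − a)², so the criterion is in fact an equivalence). [difficulty:
provable-now] [Kato1989, Kato1994Ramification, Matsumura1987]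

TWO-LAYER PLAN. Foreseen glued split of CoverResolution (filed as INFORMAL statement items right
after open; typed once the definition requests
land): CoverResolution ⇐ CleanSolvableModel → CleanCoverLogRegular → LogRegularResolutionGlobal →
CoverResolution, where
(a) CleanSolvableModel_p (rank 2): for V → A^n_k finite etale connected there is a projective
birational W' → P^n_k, isomorphic off
H, W' REGULAR, D' = (preimage of H)_red snc, such that on the normalisation of W' in the Galois
closure V^g every inertia group has
a normal p-Sylow (AbbesSaito2011 Def. 7 (NpS), Prop. 15 unconditional but with singular W'; Prop. 76
with snc W' only under strong
resolution (RS)) AND V^g is clean along D' layer by layer (tame quotient Kummer; each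
elementary-abelian p-layer given, etale
locally on the stage below, by Artin–Schreier classes u·μ^{-1} with u a unit and μ a monomial of the
log structure, and, where μ is a
p-th power, d u transversal to the log strata) — AbbesSaito2011 §1.13 'we may optimistically
expect', Yatagawa2022 p. 2 'expected
to be satisfied even in general', Kato1994Ramification Thm 4.1 (dim 2, rank 1); (b)
CleanCoverLogRegular_p (rank 3): the
normalisation of such (W', D') in V (and in every intermediate cover) is log-regular for a log
structure containing the preimage of
D' (tame: GrothendieckMurre1971 2.3.2; mixed wild layer: etale-locally x^R = π^p, toric; fierce
layer: FierceCleanRegular; p = 3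
fierce×wild crossing z^3 − z = 1/(x^3 y) checked by hand: normalisation ≅ k[x, s], y = s^3/(1 − x^2
s^2), regular); (c)
LogRegularResolutionGlobal (rank 5): Kato1994 (10.4) / Niziol2006 Thm 5.8 for fs log-regular schemes
with several charts (the
tree vendors only the one-chart case
Literature.AlgebraicGeometry.Resolution.Kato1994_logRegular_hasResolution). First testbed
(rank 4, informal): ASCoverResolution_p — the degree-p Artin–Schreier covers z^p − z = f(t_1, …,
t_n) of A^n, where (a) is
literally Kato's rank-1 cleaning expectation and (b) is (FierceCleanRegular + the toric lemma).

KILL CRITERIA. ¬CoverResolution is ¬summit over a perfect field (a PROBLEM DECIDER: file the witness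
as a refutation of the summit, do not just
close the route). KedlayaReduction refuted ⇒ mis-typing only: restate from Kedlaya2004 Thm 1
verbatim (repair, not close). The
LINE (not the typed cruxes) dies if CleanCoverLogRegular fails already for surfaces: a clean, (NpS)
cover of a regular surface snc
pair whose normalisation is not toroidal — then close `superseded` in favour of card wild-jung's
Hahn–Kedlaya arm (E3') or retire;
it is demoted if CleanSolvableModel provably needs cover-side blow-ups (Kedlaya card NoGo made
rigorous at the level of absolute
log-regularity, not of monomial maps). Proof of DescentPerfectToAll elsewhere is shared progress; a
functorial resolution over
perfect fields (WeightedInvariant) moots the route.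

NOT DECOMPOSED YET. The three engine items and ASCoverResolution are informal until the definitions
(Kato/Abbes–Saito cleanliness along an snc
divisor, property (NpS), global fs log-regularity) land; the Lean discharge of KedlayaReduction
(Kedlaya2004 Thm 1 as a cite fact — the ONE external fact this route genuinely needs, not yet
vendored;
projectivity of the normalisation, linear coordinate change on Proj; the projective reduction is in
tree); CONE HYGIENE (rev 1): none of the 15 unproved named facts that rev 0's import of
`Theorems/WeightedInvariantWeightedThesisProjectiveIntegralSuffices` dragged in (de Jong
alterations, Cossart–Jannsen–Saito, Cossart–Piltant LU, Temkin 2013, Abramovich–Oort) is used by any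
item or by the glue — they rode in on `Literature/AlgebraicGeometry/Resolution/{AlterationsStrong,
ResolutionProjectiveReduction}`'s own imports; a Theorems file proving KedlayaReduction via
`stub_projectiveIntegralSuffices` will re-import them unless a librarian first moves
`exists_topologicalKrullDim_le_of_locallyOfFiniteType` and the components/Chow/projective-closure
chain to fact-free modules (recommended); the non-abelian p-inertia case of (b) (quaternion-type
inertia in characteristic 2) and the question whether (a) needs embedded resolution of the non-clean
locus inside H (dimension
n − 1) as an input — all layer-2, after a crux moves (D-0019).

CHEAPEST FALSIFIER. Dimension 2, where CoverResolution is a theorem but the ENGINE is falsifiable: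
(i) normalise the log-clean fierce×wild crossing
z^p − z = 1/(x^p y) and a clean (Z/p)^2-cover with equal conductors at a point where u_2 ∈ F_p, and
check toroidality — done by
hand for p = 3 (regular: k[x,s]) and for z^2 − z = y/x (A_1 cone w^2 = x(w + y), toric); (ii) a
computer-algebra normalisation
(kit, Singular `normal` in char 2) of a clean QUATERNION Q_8-cover of (A^2, line): if its
normalisation is not toroidal after any
point blow-ups of the base, CleanCoverLogRegular is false beyond abelian inertia and the line
shrinks to ASCoverResolution; (iii)
lookup done: Piltant2003 Thm 7.1 (weak Jung property for every degree-p separable extension of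
surfaces: toric top after base
blow-ups along any valuation) and Example 3.4(2) (cone over a degree-p curve: NOT toric before
further base blow-ups) are both
consistent with (a)+(b); Cutkosky2014 (Literature.Barriers.ResolutionOfSingularities.Cutkosky2014: u
= x^p(1+y), v = y^p + x,
no weak local monomialisation) has a REGULAR top k[x,y], so it tests monomiality of the MAP, which
this line never asserts.

NUMBERS. Known cases the engine must reproduce: dim 2 (Piltant2003 Thms 5.3/6.5/7.1;
Kato1994Ramification Thm 4.1 cleaning by point
blow-ups); dim 3 (CossartPiltant2019, where 'hundreds of pages' treat exactly the
discriminant-condition singularities,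
MourtadaSchober2025 p. 3). Kedlaya2004 Thm 1 holds over EVERY field of characteristic p for
geometrically reduced projective X
(finite fields included). Items at open: 5 typed (3 cruxes, 1 support, 1 assembly) + 4 informal
statements + 3 definition and
4 cite requests filed after open.

DEFINITION REQUESTS. Definitions (Literature/AlgebraicGeometry/Ramification, new topic): KatoClean
(Kato1989 / Kato1994Ramification (3.4.3) log-cleanliness
of a rank-1 sheaf = Artin–Schreier–Witt class along an snc divisor of a regular scheme; then
AbbesSaito2011 Def. (clean8) for
Galois torsors); InertiaNormalSylow = property (NpS) (AbbesSaito2011 Def. 7: inertia groups of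
geometric points of the integral
closure have a normal p-Sylow); LogRegularScheme (Kato1994 Def. 2.1 with several Zariski fs charts,
extending the tree's one-chart
LogChart.IsLogRegularAt). Cite facts: Kedlaya2004 Thm 1 (arXiv:math/0303382); AbbesSaito2011 Prop.
15 (= (NS4): U-admissible
blow-up + normalisation ⇒ (NpS) everywhere, unconditional); Kato1994Ramification Thm 4.1 (rank-1
cleaning on surfaces);
Kato1994 (10.4) + Niziol2006 Thm 5.8 global (log-regular ⇒ HasResolution, several charts).

Novelty: Searches (2026-08-16): `lit frontier ResolutionOfSingularities --since 2020 --source local` (25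
rows; no Kedlaya/Abbes–Saito/Jung
descendants; arXiv:2307.00416 ramification-side only); `lit search --source arxiv "ramification
cleanliness"` (1 relevant:
arXiv:1007.3873), `"Yatagawa characteristic cycle rank one sheaf ramification"` (arXiv:1712.09234,
arXiv:2206.02989 — read p. 2),
`"Saito wild ramification characteristic cycle l-adic sheaf"` (arXiv:0705.2799, arXiv:1007.0310);
`lit citing doi:10.5802/aif.1978`
(11: Cutkosky arXiv:2111.12818 read p. 4, arXiv:2302.07710, Benito–Villamayor, Cossart–Piltant —
none globalises the Jung property);
`lit galaxy search "refined Swan conductor" --star pdf` (3, none on resolution), `"clean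
ramification blow-up higher dimension Kato
conjecture rank one sheaf" --star all` (0); `lit read` arXiv:math/0303382 pp. 2–3 (Thm 1 verbatim),
arXiv:1007.3873 §1.6, §1.13,
Def. 7, Prop. 15, Prop. 76, doi:10.5802/aif.1978 pp. 1237–1242, arXiv:2502.01239 pp. 3–4;
zbMATH/OpenAlex/S2 rate-limited (logged);
`lean search` ProjectiveSpace/Etale/HasResolution/LogRegular (tree has projectiveSpace, Etale,
Kato1994_logRegular_hasResolution
one-chart, IsStrictNormalCrossingsDivisor; no Swan/clean). Cards read: kedlaya-normal-form,
wild-jung-ramification-hahn (both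
graded new-combination, unrouted), clean-differential, alpha-p-to-mu-p-foliation-reduction (titles).
Nearest prior art found: Piltant2003 (doi:10.5802/aif.1978: valuative Jung property for SURFACES —
base  [refs: 10.5802/aif.1978`, 10.5802/aif.1978, 10.5802/aif.1978:, 2307.00416, 1007.3873, 1712.09234, 2206.02989, 0705.2799, 1007.0310, 2111.12818, 2302.07710, math/0303382, 2502.01239, doi:10.5802/aif.1978, Piltant2003, Abhyankar1955, AbbesSaito2011, Kedlaya2004, MourtadaSchober2025]

Barriers (technique_class: kedlaya-cover ramification-cleanliness log-regularity): - technique_class: kedlaya-cover ramification-cleanliness log-regularity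
- Literature.Barriers.ResolutionOfSingularities.chevalley_barrier: APPLIES to the ancestor
(Abhyankar–Jung: Puiseux/Kummer roots of the discriminant equation fail for wild covers,
ArtinSchreierPuiseuxNarrow); evaded by never extracting roots along H: the tame part alone goes
through Abhyankar's lemma (GrothendieckMurre1971 2.3.2, all characteristics), the wild part is kept
as Artin–Schreier layers and attacked through conductors; terminal objects are log-regular, not
k((x^{1/N}))-parametrised.
- Literature.Barriers.ResolutionOfSingularities.Cutkosky2014: does NOT bite: it forbids (weak) local
MONOMIALISATION of the finite map along a defect-2 valuation; this line asserts only ABSOLUTE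
log-regularity of the normalised cover after base blow-ups, and Cutkosky's own extension u =
x^p(1+y), v = y^p + x has a regular top k[x,y] (log-regular for the preimage {x = 0} ∪ {y = −1} of u
= 0) — an instance, not a counterexample; the NoGo of card kedlaya-normal-form is thereby restricted
to map-level toroidality (recorded in NOTES ## Barrier notes).
- Literature.Barriers.ResolutionOfSingularities.DimensionFourFrontier: partly evaded, honestly not
escaped: no LU, no patching, no ELU_n as such; but CleanSolvableModel in P^n plausibly contains
embedded resolution of the non-clean locus inside H ≅ P^{n-1} (one dimension DOWN, not n) — the bet
is that conductor data (coherent, divisor-supported: refined Swan conductors are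

History (route lifecycle, newest last):
- 2026-08-16T14:52:34Z · rev 2: restated KedlayaReduction (stmt-ResolutionOfSingularities-15105) — route-repair(cone): rev 0's deciding theorem invoked `Theorems.WeightedThesis.ProjectiveIntegralSuffices.stub_projectiveIntegralSuffices`, and that Theorems mod (planner-rrepair-ResolutionOfSingularities-Clea-1752f304-0)
- 2026-08-25T06:23:36Z · DORMANT — reconciler: no traction for 7.5 d (last activity item-evidence-added at 2026-08-17T19:03:53Z); parked, not closed — `ledger route dormant route-ResolutionOfSing (operator:999:1255469)
- 2026-08-26T17:00:38Z · REACTIVATED — reconciler: reactivated — activity statement-claimed at 2026-08-26T16:25:04Z after parking at 2026-08-25T06:23:36Z (operator:999:3487878)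
- 2026-08-29T19:42:32Z · DORMANT — census g0: costume|duplicate of —; reader census-reader-61-g0 (operator:999:1739497)

sub-problem: ResolutionOfSingularities · status: dormant · opened planner-plan-novel-ResolutionOfSingularities-Re-dc19aa3a-a-0 2026-08-16T14:39:35Z · rev 3 · ledger route-ResolutionOfSingularities-CleanCovers
GENERATED by the gate from the ledger (D-0016/17). Provers cite these decls: `theorem foo : Summit.ResolutionOfSingularities.ResolutionOfSingularities.Theses.CleanCovers.<Decl> := …` in Summits/ResolutionOfSingularities/ResolutionOfSingularities/Theorems/<Name>.lean.
-/

namespace Summit.ResolutionOfSingularities.ResolutionOfSingularities.Theses.CleanCovers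

open scoped BigOperators Topology Manifold Classical MeasureTheory ProbabilityTheory Matrix InnerProductSpace ComplexConjugate ContinuousMap
open Filter Set Function TopologicalSpace MeasureTheory

attribute [summit_statement] _root_.ResolutionOfSingularities

/-- item stmt-ResolutionOfSingularities-15104 · crux · rank 2 · open · by planner
why it might fail: equivalent to the summit over perfect fields (Kedlaya), open in dim ≥ 4; the engine's clean models may need blow-ups of the COVER (non-abelian p-inertia; embedded resolution of the non-clean locus inside H, dim n-1) — then base-only cleaning stalls.
sources: Kedlaya2004, AbbesSaito2011, Piltant2003, Kato1994Ramification, Yatagawa2022, arXiv:math/0303382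
[crux] for every prime p, every perfect field k of characteristic p, every n, every integral scheme
X and every finite surjective f : X → P^n_k which is etale over the chart D_+(x_n) ≅ A^n_k, X has a
resolution (proper birational X' → X with X' regular). The Kedlaya normal form of the summit over
perfect fields (card kedlaya-normal-form, K0/CoverRes_n); attacked by the cleaning engine (Two-layer
plan). [difficulty: open-problem] -/
@[route_item "route-ResolutionOfSingularities-CleanCovers", crux]
def CoverResolution : Prop :=
  ∀ p : ℕ, p.Prime → ∀ (k : Type) [Field k] [CharP k p] [PerfectField k] (n : ℕ) (X : AlgebraicGeometry.Scheme.{0}) (f : X ⟶ (Literature.AlgebraicGeometry.Motives.projectiveSpace n k).left), AlgebraicGeometry.IsIntegral X → AlgebraicGeometry.IsFinite f → Function.Surjective f.base → (letI := MvPolynomial.gradedAlgebra (σ := Fin (n + 1)) (R := k); AlgebraicGeometry.Etale (f ∣_ (AlgebraicGeometry.Proj.basicOpen (MvPolynomial.homogeneousSubmodule (Fin (n + 1)) k) (MvPolynomial.X (Fin.last n))))) → Literature.AlgebraicGeometry.Resolution.Scheme.HasResolution X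

-- item stmt-ResolutionOfSingularities-15108 · crux · rank 2 · open · by planner — informal only, no Lean statement yet:
--   [crux] CleanSolvableModel_p (layer-2 child of CoverResolution, first of the glued split
--   CleanSolvableModel → CleanCoverLogRegular → LogRegularResolutionGlobal → CoverResolution). For every
--   prime p, perfect field k of char p, n ≥ 1 and every finite etale connected V → A^n_k = D_+(x_n) ⊂
--   P^n_k, there is a projective birational W' → P^n_k which is an isomorphism over A^n_k, with W'
--   REGULAR and D' := (preimage of the hyperplane H = V_+(x_n))_red a strict normal crossings divisor,
--   such that, writing V^g for the Galois closure of V over A^n and Y' for the normalisation of W' in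
--   V^g: (i) (NpS) at eve

-- earlier KedlayaReduction (stmt-ResolutionOfSingularities-15105, replaced 2026-08-16T14:52:34Z -> stmt-ResolutionOfSingularities-15241): retired by None — ∀ p : ℕ, p.Prime → (∀ (k : Type) [Field k] [CharP k p] [PerfectField k] (n : ℕ) (X : AlgebraicGeometry.Scheme.{0}) (f : X ⟶ (Literature.AlgebraicGeometry.Motives.projectiveSpace n k).left), AlgebraicGeometry.IsIntegral X → AlgebraicGeometry.IsFin
/-- item stmt-ResolutionOfSingularities-15241 · crux · rank 3 · closed · proved by Summit.ResolutionOfSingularities.ResolutionOfSingularities.Theorems.kedlayaReduction_proof @ 3c0fb96cee4e (prover) · by planner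
why it might fail: only if mis-typed: Kedlaya's 'etale away from H' must match `Etale (f ∣_ D_+(x_n))` after a linear coordinate change on Mathlib's Proj, and X^ν must be projective (finite over projective) to carry the ample L; the added first step (finite type ⇒ integral closed X ⊆ P^n) is PROVED in tree.
sources: Kedlaya2004, arXiv:math/0303382, arXiv:math/0207150, CossartPiltant2019
[crux] for every prime p: CoverResolution at p ⇒ every reduced separated scheme of finite type over
a perfect field k of characteristic p has a resolution (the conclusion is verbatim the hypothesis of
DescentPerfectToAll at p). Proof on paper: the PROVED tree reduction
`Theorems.WeightedThesis.ProjectiveIntegralSuffices.stub_projectiveIntegralSuffices` =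
`ResolutionOverUpToDim.of_projective` (irreducible components with reduced structure, Chow,
projective closure; CossartPiltant2019 Prop. 4.6 Steps 1–3) reduces to integral closed subschemes X
⊆ P^n_k; normalise X (tree: Scheme.HasResolution.of_normalization; X^ν is projective, finite over
projective); Kedlaya2004 Thm 1 (arXiv:math/0303382) with L = O(1), D = the non-smooth locus (dim <
dim X since k is perfect, so X^ν is geometrically reduced), S = ∅ gives a finite f : X^ν → P^d etale
away from ONE hyperplane, which a linear change of coordinates makes V_+(x_d); f is surjective since
dim X^ν = d; CoverResolution at p resolves X^ν, hence X. Restated at rev 1 (cone repair) from the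
rev-0 form, which concluded only for integral closed X ⊆ P^n_k and left the projective reduction to
the glue: the deciding theorem is now pure logic and t -/
@[route_item "route-ResolutionOfSingularities-CleanCovers", crux]
def KedlayaReduction : Prop :=
  ∀ p : ℕ, p.Prime → (∀ (k : Type) [Field k] [CharP k p] [PerfectField k] (n : ℕ) (X : AlgebraicGeometry.Scheme.{0}) (f : X ⟶ (Literature.AlgebraicGeometry.Motives.projectiveSpace n k).left), AlgebraicGeometry.IsIntegral X → AlgebraicGeometry.IsFinite f → Function.Surjective f.base → (letI := MvPolynomial.gradedAlgebra (σ := Fin (n + 1)) (R := k); AlgebraicGeometry.Etale (f ∣_ (AlgebraicGeometry.Proj.basicOpen (MvPolynomial.homogeneousSubmodule (Fin (n + 1)) k) (MvPolynomial.X (Fin.last n))))) → Literature.AlgebraicGeometry.Resolution.Scheme.HasResolution X) → ∀ (k : Type) [Field k] [CharP k p] [PerfectField k] (X : AlgebraicGeometry.Scheme.{0}) (f : X ⟶ AlgebraicGeometry.Spec (.of k)), AlgebraicGeometry.IsSeparated f → AlgebraicGeometry.LocallyOfFiniteType f → AlgebraicGeometry.QuasiCompact f → AlgebraicGeometry.IsReduced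 X → Literature.AlgebraicGeometry.Resolution.Scheme.HasResolution X

-- `KedlayaReduction` holds: proved by `Summit.ResolutionOfSingularities.ResolutionOfSingularities.Theorems.kedlayaReduction_proof` @ 3c0fb96cee4e (its module imports this route file, so no `_holds` link can be stated here).

/-- item stmt-ResolutionOfSingularities-0549 · crux · rank 4 · open · by planner
why it might fail: regular is not geometrically regular under inseparable ground-field extension (EGA IV 6.7.4, Literature.Barriers.ResolutionOfSingularities.RegularNotGeometricallyRegular); spreading out needs k/K0 separable beyond the p-rank of k (Temkin2008 Q 3.3.3 open).
sources: Temkin2008, CossartPiltant2009, Liu2002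
PerfectToAll: for a prime p, resolution of all reduced separated finite-type schemes over all
PERFECT fields of char p implies ResolutionInChar p (all fields of char p). Expected inputs:
Neron-Popescu (Stacks 07GC), spreading out, openness of regular locus on excellent schemes;
regularity is not stable under inseparable ground field extension, which is the difficulty. -/
@[route_item "route-ResolutionOfSingularities-CleanCovers", crux]
def DescentPerfectToAll : Prop :=
  ∀ p : ℕ, p.Prime → (∀ (k : Type) [Field k] [CharP k p] [PerfectField k] (X : AlgebraicGeometry.Scheme.{0}) (f : X ⟶ AlgebraicGeometry.Spec (.of k)), AlgebraicGeometry.IsSeparated f → AlgebraicGeometry.LocallyOfFiniteType f → AlgebraicGeometry.QuasiCompact f → AlgebraicGeometry.IsReduced X → Literature.AlgebraicGeometry.Resolution.Scheme.HasResolution X) → Literature.AlgebraicGeometry.Resolution.ResolutionInChar.{0} p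

/-- item stmt-ResolutionOfSingularities-19706 · crux · rank 5 · open · by planner
why it might fail: True in print (CP2019 Thm 1.1 + Prop 4.4, ~270 pp over CoP1-CoP3; CJS2020 Thm 1.2); can fail only through vendoring: all-affine-opens quasi-excellence, IsResolution's birationality, iso over an open U = Reg X, CJS as ONE Sing-centred blow-up with regular source.
sources: CossartPiltant2019, CossartJannsenSaito2020, CossartPiltant2008, CossartPiltant2009, arXiv:1412.0868, Piltant2013
[crux] PRINTED RESOLUTION INPUTS IN DIMENSION ≤ 3 (known in print; Lean formalisation debt, XL). The
conjunction, at universe 0 and stated over tree DEFINITIONS only (no named-fact constant, so no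
unproved fact enters the route cone), of: (i) Cossart–Piltant 2019 Thm 1.1 — every reduced separated
Noetherian quasi-excellent scheme of dimension ≤ 3 has a resolution (proper, birational, regular
source: IsResolution) which is an isomorphism over an open U with |U| = Reg X; (ii) Cossart–Piltant
2019 Prop 4.4 (= CoP1 Prop 4.2 + CoP3 Thm II.3) — every non-zero ideal sheaf on a regular excellent
integral Noetherian scheme of dimension 3 is principalized by a regular-centre blow-up sequence;
(iii) Cossart–Jannsen–Saito 2020 Thm 1.2 in single-blow-up format — every reduced excellent
Noetherian scheme of dimension ≤ 2 AdmitsDesingularization (one blow-up with centre in Sing X and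
regular source; the format follows from the printed permissible sequence by Temkin 2008 §2.1-2.2 /
Stacks 080B). DEFINITIONALLY (Iff.rfl, checked) this is CossartPiltant2019General.{0} ∧
CossartPiltant2019Principalization.{0} ∧ (CJS format) = the registered stub `stub_printedInputs` of
line closed-point-slice of the -/
@[route_item "route-ResolutionOfSingularities-CleanCovers"]
def PrintedResolutionDimLeThree : Prop :=
  (∀ (X : AlgebraicGeometry.Scheme.{0}) [X.IsSeparated] [AlgebraicGeometry.IsNoetherian X] [AlgebraicGeometry.IsReduced X], Literature.AlgebraicGeometry.Resolution.Scheme.IsQuasiExcellent X → topologicalKrullDim X ≤ 3 → ∃ (X' : AlgebraicGeometry.Scheme.{0}) (π : X' ⟶ X), Literature.AlgebraicGeometry.Resolution.IsResolution π ∧ ∃ U : X.Opens, (U : Set X) = Literature.AlgebraicGeometry.Resolution.Scheme.regularLocus X ∧ CategoryTheory.IsIso (π ∣_ U)) ∧ (∀ (S : AlgebraicGeometry.Scheme.{0}) [AlgebraicGeometry.IsIntegral S] [AlgebraicGeometry.IsNoetherian S], Literature.AlgebraicGeometry.Resolution.Scheme.IsRegular S → Literature.AlgebraicGeometry.Resolution.Scheme.IsExcellent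 S → topologicalKrullDim S = 3 → ∀ J : S.IdealSheafData, J ≠ ⊥ → ∃ (S' : AlgebraicGeometry.Scheme.{0}) (σ : S' ⟶ S), Literature.AlgebraicGeometry.Resolution.IsRegularCentreBlowupSeq σ J ∧ Literature.AlgebraicGeometry.Resolution.IsLocallyPrincipal (J.comap σ)) ∧ (∀ (X : AlgebraicGeometry.Scheme.{0}) [AlgebraicGeometry.IsNoetherian X] [AlgebraicGeometry.IsReduced X], Literature.AlgebraicGeometry.Resolution.Scheme.IsExcellent X → topologicalKrullDim X ≤ 2 → Literature.AlgebraicGeometry.Resolution.Scheme.AdmitsDesingularization X)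

-- item stmt-ResolutionOfSingularities-15109 · support · rank 3 · open · by planner — informal only, no Lean statement yet:
--   [crux] CleanCoverLogRegular_p (layer-2 child of CoverResolution; the STRUCTURE theorem of the line).
--   Let k be perfect of char p, (W', D') a regular scheme of finite type over k with a strict normal
--   crossings divisor, V → W' ∖ D' finite etale connected whose Galois closure V^g satisfies (i) (NpS)
--   and (ii) layerwise cleanliness of item CleanSolvableModel at every point. Then the normalisation X'
--   of W' in V — and the normalisation of W' in every intermediate extension of V^g/k(W') — is
--   LOG-REGULAR (Kato1994 Def. 2.1, fs charts on the Zariski or etale site) for a log structure whose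
--   non-triviality

-- item stmt-ResolutionOfSingularities-15117 · support · rank 4 · open · by planner — informal only, no Lean statement yet:
--   [crux] ASCoverResolution_p — the rank-1 TESTBED of CoverResolution (stmt-15104): for every prime p,
--   perfect field k of char p, n ≥ 1 and every polynomial f ∈ k[t_1, …, t_n] with z^p − z − f
--   irreducible, the normalisation X_f of P^n_k in the Artin–Schreier extension k(t_1, …, t_n)(z), z^p −
--   z = f (equivalently: Mathlib's relative normalisation `Scheme.Hom.normalization` of Spec
--   k[t][z]/(z^p − z − f) → A^n_k = D_+(x_n) ↪ P^n_k; the affine part is SMOOTH since ∂/∂z = −1, so all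
--   singularities sit over the hyperplane at infinity) has a resolution (Scheme.HasResolution). This is
--   exactly the case whe

/-- item stmt-ResolutionOfSingularities-15118 · support · rank 5 · open · by planner
[crux] LogRegularResolutionGlobal — the terminal step of the glued split of CoverResolution (known
mathematics, unvendored in the needed generality; crux only by the crux-only rule for hypotheses of
the future split glue): every fs LOG-REGULAR scheme (X, M) of finite type over a field (Kato1994
Def. 2.1 / condition (S) with FINITELY MANY Zariski charts by fs monoids; also wanted: the
etale-chart version, Niziol2006 §5 / Gabber's very tame variant in Illusie–Laszlo–Orgogozo 2014 Exp.
VIII–X) admits a resolution in the tree's sense (Scheme.HasResolution: proper birational X' → X with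
X' regular), namely the base change (X, M) ×_{F(X)} F' along a regular proper subdivision F' of the
fan F(X) (Kato1994 (9.8) = KKMS I Thm 11, (9.11) proper, (10.3) birational, (10.4) regular) or a
single log blow-up (Niziol2006 Thm 5.8: 'Any log-regular Zariski scheme (X, M_X) can be
desingularized by a log-blow-up'). The tree vendors only the ONE-CHART affine case as the named fact
Literature.AlgebraicGeometry.Resolution.Kato1994_logRegular_hasResolution
(LogRegularResolution.lean, with LogChart.IsLogRegularAt); this item asks for several charts (the
normalised Kedlaya cover of item CleanCoverLogRegular -/
@[route_item "route-ResolutionOfSingularities-CleanCovers"]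
def LogRegularResolutionGlobal : Prop :=
  Literature.AlgebraicGeometry.Resolution.Niziol2006_logRegularScheme_hasResolution.{0}

/-- item stmt-ResolutionOfSingularities-15106 · support · rank 9 · open · by planner
sources: Kato1989, Kato1994Ramification, Matsumura1987
[support] the fierce-clean Artin–Schreier layer is regular (first lemma of 'clean ⇒ log-regular'): A
a regular local ring of characteristic p, x ∈ m, e ≥ 1, u, a ∈ A with u − a^p ∈ m and u − a^p +
x^{e(p−1)}·a ∉ m² (this is implied by Kato log-cleanliness of the class u/x^{pe} at the closed
point); then every localisation of A[w]/(w^p − x^{e(p−1)} w − u) at a prime over m is a regular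
local ring (the unique such prime is (m, w − a); the hypersurface equation is ≡ −(u − a^p +
x^{e(p−1)}a) mod (m, w − a)², so the criterion is in fact an equivalence). [difficulty:
provable-now] -/
@[route_item "route-ResolutionOfSingularities-CleanCovers"]
def FierceCleanRegular : Prop :=
  ∀ (p : ℕ) [Fact p.Prime] (A : Type) [CommRing A] [IsRegularLocalRing A] [CharP A p] (x u a : A) (e : ℕ), 1 ≤ e → x ∈ IsLocalRing.maximalIdeal A → u - a ^ p ∈ IsLocalRing.maximalIdeal A → u - a ^ p + x ^ (e * (p - 1)) * a ∉ (IsLocalRing.maximalIdeal A) ^ 2 → ∀ (P : Ideal (AdjoinRoot (Polynomial.X ^ p - Polynomial.C (x ^ (e * (p - 1))) * Polynomial.X - Polynomial.C u : Polynomial A))) [P.IsPrime], Ideal.comap (algebraMap A _) P = IsLocalRing.maximalIdeal A → IsRegularLocalRing (Localization.AtPrime P)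

/-- item stmt-ResolutionOfSingularities-15107 · assembly · rank 1 · open · by planner
sources: Kedlaya2004, CossartPiltant2019
[assembly] CoverResolution → KedlayaReduction → DescentPerfectToAll → the summit. -/
@[route_item "route-ResolutionOfSingularities-CleanCovers"]
def Assembly : Prop :=
  CoverResolution → KedlayaReduction → DescentPerfectToAll → _root_.ResolutionOfSingularities

/-! D-0027 §2.1 — DECIDING THEOREM (planner-authored via `route open/edit --closes-file`; by planner-rrepair-ResolutionOfSingularities-Clea-1752f304-0 2026-08-16T14:52:34Z):
its hypotheses are this route's items and its conclusion the sub-problem Statement (glue_lint), and it elaborates with this file. -/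

/-- Deciding theorem (D-0027 §2.1), pure logic: fix a prime `p`; `CoverResolution` at `p` feeds
`KedlayaReduction`, which yields resolution of every reduced separated finite-type scheme over every
perfect field of characteristic `p` (Kedlaya normal form + normalisation + the in-tree projective
reduction: components, Chow, projective closure); `DescentPerfectToAll` upgrades that to
`ResolutionInChar p`. No tree theorem is invoked here, so the route file imports no
`Literature.AlgebraicGeometry.Resolution.*` module beyond the Statement's own (cone repair, rev 1). [folklore] -/
@[closes "route-ResolutionOfSingularities-CleanCovers"] theorem closes (hC : CoverResolution) (hK : KedlayaReduction) (hD : DescentPerfectToAll) :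
    _root_.ResolutionOfSingularities :=
  fun p hp => hD p hp (hK p hp (hC p hp))

end Summit.ResolutionOfSingularities.ResolutionOfSingularities.Theses.CleanCovers
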